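import Mathlib
import Summits.Ventures.HodgeRepro.Tier4.Line1.RTFSetting
import Summits.Ventures.HodgeRepro.Tier4.Line1.RtfUnfold
import Summits.Ventures.HodgeRepro.Tier4.Line1.RtfSpectralStep
import Summits.Ventures.HodgeRepro.Tier4.Line1.KernelSupportFinite
import Summits.Ventures.HodgeRepro.Tier4.Line1.KernelUnfold
import Summits.Ventures.HodgeRepro.Tier4.Line1.KernelOperator
import Summits.Ventures.HodgeRepro.Tier4.Line1.KernelOpEqR
import Summits.Ventures.HodgeRepro.Tier4.Line1.KernelEigen
import Summits.Ventures.HodgeRepro.Tier4.Line1.KernelCompact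
import Summits.Ventures.HodgeRepro.Tier4.Line1.InnerCalculus

/-!
# Tier4/Line1/KernelAdjoint — LINE L1, towards J1-(4b): the adjoint kernel operator and the spectral input R-D

Blind re-derivation cell `pub-hodge-repro`, Tier 4 «prove the step» (README §9–§10), seat t4-L1-p4 (prover, gen 0;
J1-(4b) `exists_irreducible_invariant_subspace` (Skeleton v0.16 L444) as census + rungs, S12549; module 2 after
`InnerCalculus`).  Generic Part I over every `RTF.Setting G`; imports the landed kernel-operator layer of
t4-L1-p1 / t4-L1-p3 by name (`kernelOp`, `exists_kernelCLM`, `kernelOp_eq_R`, `continuous_kernelOp`,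
`kernelOp_invariant`, `kernelCLM_isCompactOperator`).

* H-1 / H-2 (Hilbert space, Mathlib only): a non-zero compact symmetric operator has a non-zero eigenvalue with a
  non-zero eigenvector, also on a closed invariant subspace on which it is non-zero
  (`ContinuousLinearMap.eq_zero_of_forall_hasEigenvalue_eq_zero`, `IsCompactOperator.restrict'`).
* K-1 `kernelCLM_adjoint`: `⟪T_{f*} u, v⟫ = ⟪u, T_f v⟫` on all of `L²(DG)` (`f* = conj fˇ`; Fubini on `DG × DG` with
  the bounded kernel, `G` second countable); K-2 `T_{f*} ∘ T_f` symmetric; K-3 `⟪(T_{f*} ∘ T_f) u, u⟫ = ‖T_f u‖²`;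
  K-4 `T_{f*} ∘ T_f` compact (rung (2)).
* `classes V` = the `L²(DG)`-classes of an invariant subspace `V` (a submodule), stable under every kernel operator
  (`kernelCLM_mapsTo_classes`, `kernelCLM_mapsTo_closure`).
* R-D `exists_eigen_mem` — THE SPECTRAL INPUT of (4b), with rung (4a) as the displayed hypothesis `h4a`: a
  relatively closed invariant `V` with a non-zero member contains a non-zero `ψ` with `R(f*)(R(f)ψ) = μ ψ`,
  `μ ≠ 0`, for some test function `f` — the compact self-adjoint `T_{f*} ∘ T_f` is non-zero on the closure of
  `classes V` (by (4a) and K-3), H-2 gives an eigenvector there, `μ⁻¹ · K_{f*}(T_f u)` is its continuous invariant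
  representative (rung (3)'s method: `continuous_kernelOp`, `kernelOp_invariant`), in `V` by relative closedness.

Nothing here says anything about the status of the Hodge conjecture for CM abelian varieties, which is NOT proved;
HC_CM is NOT proved by anyone in this repository.
-/

set_option autoImplicit false

noncomputable section

namespace Summit.Ventures.HodgeRepro.Tier4.Line1

open MeasureTheory Topology Filter Set
open scoped Uniformity Pointwise InnerProductSpace ComplexConjugate

namespace RTF

section Hilbert

variable {E : Type} [NormedAddCommGroup E] [InnerProductSpace ℂ E] [CompleteSpace E]

/-- H-1: a non-zero compact symmetric operator on a complex Hilbert space has a non-zero eigenvalue with a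
non-zero eigenvector (Mathlib's `ContinuousLinearMap.eq_zero_of_forall_hasEigenvalue_eq_zero`). -/
theorem exists_eigenvector_of_ne_zero {T : E →L[ℂ] E} (hc : IsCompactOperator T)
    (hs : (T : E →ₗ[ℂ] E).IsSymmetric) (hT : T ≠ 0) :
    ∃ μ : ℂ, μ ≠ 0 ∧ ∃ u : E, u ≠ 0 ∧ T u = μ • u := by
  have h := (ContinuousLinearMap.eq_zero_of_forall_hasEigenvalue_eq_zero hc hs).not.mpr hT
  push Not at h
  obtain ⟨μ, hμ, hμ0⟩ := h
  obtain ⟨u, hu⟩ := hμ.exists_hasEigenvector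
  exact ⟨μ, hμ0, u, hu.2, Module.End.mem_eigenspace_iff.mp hu.1⟩

/-- H-2: the same on a closed invariant subspace `W` on which `T` is not zero. -/
theorem exists_eigenvector_mem_of_ne_zero {T : E →L[ℂ] E} (hc : IsCompactOperator T)
    (hs : (T : E →ₗ[ℂ] E).IsSymmetric) {W : Submodule ℂ E} (hW : IsClosed (W : Set E))
    (hinv : ∀ w ∈ W, T w ∈ W) (hne : ∃ w ∈ W, T w ≠ 0) :
    ∃ μ : ℂ, μ ≠ 0 ∧ ∃ u ∈ W, u ≠ 0 ∧ T u = μ • u := by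
  haveI : CompleteSpace W := hW.completeSpace_coe
  set T' : W →L[ℂ] W := T.restrict hinv with hT'
  have hc' : IsCompactOperator T' := hc.restrict' hinv
  have hs' : (T' : W →ₗ[ℂ] W).IsSymmetric := hs.restrict_invariant hinv
  have hne' : T' ≠ 0 := by
    obtain ⟨w, hwW, hw⟩ := hne
    intro h0
    apply hw
    have := congrArg (fun S : W →L[ℂ] W => (S ⟨w, hwW⟩ : E)) h0
    simpa [hT'] using this
  obtain ⟨μ, hμ, u, hu0, hu⟩ := exists_eigenvector_of_ne_zero hc' hs' hne'
  refine ⟨μ, hμ, u, u.2, fun h => hu0 (Subtype.ext h), ?_⟩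
  have := congrArg (fun x : W => (x : E)) hu
  simpa [hT'] using this

end Hilbert

variable {G : Type} [Group G] [TopologicalSpace G] [IsTopologicalGroup G] [MeasurableSpace G]
  [BorelSpace G]

namespace Setting

variable (S : Setting G)


/-- K-1: the kernel operator of `f* = conj fˇ` is the adjoint of the kernel operator of `f` on `L²(DG)`:
`⟪T_{f*} u, v⟫ = ⟪u, T_f v⟫` for ALL `u, v ∈ L²(DG)` (Fubini on `DG × DG`, the kernel bounded there,
`G` second countable). -/
theorem kernelCLM_adjoint [SecondCountableTopology G] {f : G → ℂ} (hf : IsTest f)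
    (T₁ T₂ : Lp ℂ 2 (S.μ.restrict S.DG) →L[ℂ] Lp ℂ 2 (S.μ.restrict S.DG))
    (hT₁ : ∀ ψ : Lp ℂ 2 (S.μ.restrict S.DG), ⇑(T₁ ψ) =ᵐ[S.μ.restrict S.DG] S.kernelOp (cj (refl f)) ⇑ψ)
    (hT₂ : ∀ ψ : Lp ℂ 2 (S.μ.restrict S.DG), ⇑(T₂ ψ) =ᵐ[S.μ.restrict S.DG] S.kernelOp f ⇑ψ)
    (u v : Lp ℂ 2 (S.μ.restrict S.DG)) : ⟪T₁ u, v⟫_ℂ = ⟪u, T₂ v⟫_ℂ := by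
  haveI := S.haar
  haveI : IsFiniteMeasure (S.μ.restrict S.DG) := isFiniteMeasure_restrict.mpr S.measure_DG_ne_top
  have hu0 : Integrable (fun z => u z) (S.μ.restrict S.DG) := (Lp.memLp u).integrable (by norm_num)
  have hu : Integrable (fun z => conj (u z)) (S.μ.restrict S.DG) :=
    Integrable.mono' hu0.norm (Complex.continuous_conj.comp_aestronglyMeasurable hu0.aestronglyMeasurable)
      (Eventually.of_forall fun z => by simp)
  have hv : Integrable (fun x => v x) (S.μ.restrict S.DG) := (Lp.memLp v).integrable (by norm_num)
  -- the integrand on `DG × DG` and its integrability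
  set F : G → G → ℂ := fun x z => v x * S.kernel f z x * conj (u z) with hF
  have hFi : Integrable (Function.uncurry F) ((S.μ.restrict S.DG).prod (S.μ.restrict S.DG)) := by
    have h1 : Integrable (fun p : G × G => v p.1 * conj (u p.2))
        ((S.μ.restrict S.DG).prod (S.μ.restrict S.DG)) := hv.mul_prod hu
    obtain ⟨M, -, hM⟩ := S.exists_kernel_bound hf
    have h2 : AEStronglyMeasurable (fun p : G × G => S.kernel f p.2 p.1)
        ((S.μ.restrict S.DG).prod (S.μ.restrict S.DG)) :=
      ((S.kernel_continuous hf).comp continuous_swap).aestronglyMeasurable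
    have h3 : ∀ᵐ p ∂((S.μ.restrict S.DG).prod (S.μ.restrict S.DG)), ‖S.kernel f p.2 p.1‖ ≤ M := by
      filter_upwards [S.ae_prod_mem_DG] with p hp
      exact hM _ (subset_closure hp.2) _ (subset_closure hp.1)
    have := h1.bdd_mul h2 h3
    refine this.congr (Eventually.of_forall fun p => ?_)
    simp only [hF, Function.uncurry]
    ring
  -- the left-hand side
  have e1 : ⟪T₁ u, v⟫_ℂ = ∫ x, ∫ z, F x z ∂(S.μ.restrict S.DG) ∂(S.μ.restrict S.DG) := by
    rw [L2.inner_def]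
    apply integral_congr_ae
    filter_upwards [hT₁ u] with x hx
    rw [RCLike.inner_apply, hx]
    unfold kernelOp
    rw [← integral_conj, ← integral_const_mul]
    apply integral_congr_ae
    filter_upwards with z
    simp only [hF]
    rw [S.kernel_cj, S.kernel_refl, map_mul, Complex.conj_conj]
    ring
  -- the right-hand side
  have e2 : ⟪u, T₂ v⟫_ℂ = ∫ z, ∫ x, F x z ∂(S.μ.restrict S.DG) ∂(S.μ.restrict S.DG) := by
    rw [L2.inner_def]
    apply integral_congr_ae
    filter_upwards [hT₂ v] with z hz
    rw [RCLike.inner_apply, hz]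
    unfold kernelOp
    rw [← integral_mul_const]
    apply integral_congr_ae
    filter_upwards with x
    simp only [hF]
    ring
  rw [e1, e2]
  exact integral_integral_swap hFi

/-- K-2: `T_{f*} ∘ T_f` is symmetric. -/
theorem kernelCLM_comp_isSymmetric [SecondCountableTopology G] {f : G → ℂ} (hf : IsTest f)
    (T₁ T₂ : Lp ℂ 2 (S.μ.restrict S.DG) →L[ℂ] Lp ℂ 2 (S.μ.restrict S.DG))
    (hT₁ : ∀ ψ : Lp ℂ 2 (S.μ.restrict S.DG), ⇑(T₁ ψ) =ᵐ[S.μ.restrict S.DG] S.kernelOp (cj (refl f)) ⇑ψ)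
    (hT₂ : ∀ ψ : Lp ℂ 2 (S.μ.restrict S.DG), ⇑(T₂ ψ) =ᵐ[S.μ.restrict S.DG] S.kernelOp f ⇑ψ) :
    ((T₁.comp T₂ : Lp ℂ 2 (S.μ.restrict S.DG) →L[ℂ] Lp ℂ 2 (S.μ.restrict S.DG)) :
      Lp ℂ 2 (S.μ.restrict S.DG) →ₗ[ℂ] Lp ℂ 2 (S.μ.restrict S.DG)).IsSymmetric := by
  intro u v
  show ⟪T₁ (T₂ u), v⟫_ℂ = ⟪u, T₁ (T₂ v)⟫_ℂ
  have h1 : ⟪T₁ (T₂ u), v⟫_ℂ = ⟪T₂ u, T₂ v⟫_ℂ := S.kernelCLM_adjoint hf T₁ T₂ hT₁ hT₂ (T₂ u) v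
  have h2 : ⟪T₁ (T₂ v), u⟫_ℂ = ⟪T₂ v, T₂ u⟫_ℂ := S.kernelCLM_adjoint hf T₁ T₂ hT₁ hT₂ (T₂ v) u
  rw [h1, ← inner_conj_symm u (T₁ (T₂ v)), h2, inner_conj_symm]

/-- K-3: `⟪(T_{f*} ∘ T_f) u, u⟫ = ‖T_f u‖²`. -/
theorem inner_kernelCLM_comp_self [SecondCountableTopology G] {f : G → ℂ} (hf : IsTest f)
    (T₁ T₂ : Lp ℂ 2 (S.μ.restrict S.DG) →L[ℂ] Lp ℂ 2 (S.μ.restrict S.DG))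
    (hT₁ : ∀ ψ : Lp ℂ 2 (S.μ.restrict S.DG), ⇑(T₁ ψ) =ᵐ[S.μ.restrict S.DG] S.kernelOp (cj (refl f)) ⇑ψ)
    (hT₂ : ∀ ψ : Lp ℂ 2 (S.μ.restrict S.DG), ⇑(T₂ ψ) =ᵐ[S.μ.restrict S.DG] S.kernelOp f ⇑ψ)
    (u : Lp ℂ 2 (S.μ.restrict S.DG)) :
    ⟪(T₁.comp T₂) u, u⟫_ℂ = (‖T₂ u‖ : ℂ) ^ 2 := by
  show ⟪T₁ (T₂ u), u⟫_ℂ = _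
  rw [S.kernelCLM_adjoint hf T₁ T₂ hT₁ hT₂ (T₂ u) u, inner_self_eq_norm_sq_to_K]
  rfl

/-- K-4: `T_{f*} ∘ T_f` is a compact operator (`T_f` compact, rung (2)). -/
theorem kernelCLM_comp_isCompactOperator [SecondCountableTopology G] {f : G → ℂ} (hf : IsTest f)
    (T₁ T₂ : Lp ℂ 2 (S.μ.restrict S.DG) →L[ℂ] Lp ℂ 2 (S.μ.restrict S.DG))
    (hT₂ : ∀ ψ : Lp ℂ 2 (S.μ.restrict S.DG), ⇑(T₂ ψ) =ᵐ[S.μ.restrict S.DG] S.kernelOp f ⇑ψ) :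
    IsCompactOperator (T₁.comp T₂) :=
  (S.kernelCLM_isCompactOperator hf T₂ hT₂).clm_comp T₁


omit [IsTopologicalGroup G] [BorelSpace G] in
/-- the kernel operator only sees its input up to a.e. equality on `DG`. -/
theorem kernelOp_congr_ae (f : G → ℂ) {u v : G → ℂ} (h : u =ᵐ[S.μ.restrict S.DG] v) :
    S.kernelOp f u = S.kernelOp f v := by
  ext x
  unfold kernelOp
  apply integral_congr_ae
  filter_upwards [h] with z hz
  rw [hz]

/-- the `L²(DG)`-classes of the members of an invariant subspace `V` (non-empty) form a submodule. -/
def classes (V : Set (G → ℂ)) (hV : S.IsInvariantSubspace V) (hne : V.Nonempty) :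
    Submodule ℂ (Lp ℂ 2 (S.μ.restrict S.DG)) where
  carrier := {u | ∃ ψ ∈ V, ⇑u =ᵐ[S.μ.restrict S.DG] ψ}
  add_mem' := by
    rintro u u' ⟨ψ, hψ, hu⟩ ⟨ψ', hψ', hu'⟩
    refine ⟨fun x => ψ x + ψ' x, hV.add ψ hψ ψ' hψ', ?_⟩
    filter_upwards [Lp.coeFn_add u u', hu, hu'] with x h1 h2 h3
    rw [h1, Pi.add_apply, h2, h3]
  zero_mem' := by
    obtain ⟨ψ, hψ⟩ := hne
    refine ⟨fun x => (0 : ℂ) * ψ x, hV.smul ψ hψ 0, ?_⟩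
    filter_upwards [Lp.coeFn_zero (E := ℂ) (p := 2) (μ := S.μ.restrict S.DG)] with x h1
    rw [h1, Pi.zero_apply, zero_mul]
  smul_mem' := by
    rintro c u ⟨ψ, hψ, hu⟩
    refine ⟨fun x => c * ψ x, hV.smul ψ hψ c, ?_⟩
    filter_upwards [Lp.coeFn_smul c u, hu] with x h1 h2
    rw [h1, Pi.smul_apply, smul_eq_mul, h2]

omit [IsTopologicalGroup G] [BorelSpace G] in
/-- membership in `classes V`: the class of some member of `V`. -/
theorem mem_classes_iff {V : Set (G → ℂ)} (hV : S.IsInvariantSubspace V) (hne : V.Nonempty)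
    (u : Lp ℂ 2 (S.μ.restrict S.DG)) :
    u ∈ S.classes V hV hne ↔ ∃ ψ ∈ V, ⇑u =ᵐ[S.μ.restrict S.DG] ψ := Iff.rfl

/-- the kernel operator of a test function maps the classes of `V` into themselves (`V` is `conv`-stable and
`kernelOp = R` on continuous invariant functions). -/
theorem kernelCLM_mapsTo_classes [SecondCountableTopology G] {V : Set (G → ℂ)} (hV : S.IsInvariantSubspace V)
    (hne : V.Nonempty) {f : G → ℂ} (hf : IsTest f)
    (T : Lp ℂ 2 (S.μ.restrict S.DG) →L[ℂ] Lp ℂ 2 (S.μ.restrict S.DG))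
    (hT : ∀ ψ : Lp ℂ 2 (S.μ.restrict S.DG), ⇑(T ψ) =ᵐ[S.μ.restrict S.DG] S.kernelOp f ⇑ψ) :
    ∀ u ∈ S.classes V hV hne, T u ∈ S.classes V hV hne := by
  rintro u ⟨ψ, hψ, hu⟩
  refine ⟨S.R f ψ, hV.conv ψ hψ f hf, ?_⟩
  filter_upwards [hT u] with x hx
  rw [hx, S.kernelOp_congr_ae f hu, S.kernelOp_eq_R hf (hV.inv ψ hψ) (hV.cont ψ hψ) x]

/-- the same for the topological closure. -/
theorem kernelCLM_mapsTo_closure [SecondCountableTopology G] {V : Set (G → ℂ)}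
    (hV : S.IsInvariantSubspace V) (hne : V.Nonempty) {f : G → ℂ} (hf : IsTest f)
    (T : Lp ℂ 2 (S.μ.restrict S.DG) →L[ℂ] Lp ℂ 2 (S.μ.restrict S.DG))
    (hT : ∀ ψ : Lp ℂ 2 (S.μ.restrict S.DG), ⇑(T ψ) =ᵐ[S.μ.restrict S.DG] S.kernelOp f ⇑ψ) :
    ∀ u ∈ (S.classes V hV hne).topologicalClosure, T u ∈ (S.classes V hV hne).topologicalClosure := by
  intro u hu
  rw [← SetLike.mem_coe, Submodule.topologicalClosure_coe] at hu ⊢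
  have h1 : T '' closure (S.classes V hV hne : Set _) ⊆ closure (T '' (S.classes V hV hne : Set _)) :=
    image_closure_subset_closure_image T.continuous
  have h2 : T '' (S.classes V hV hne : Set _) ⊆ (S.classes V hV hne : Set _) := by
    rintro _ ⟨w, hw, rfl⟩
    exact S.kernelCLM_mapsTo_classes hV hne hf T hT w hw
  exact closure_mono h2 (h1 ⟨u, hu, rfl⟩)

/-- R-D (THE SPECTRAL INPUT of J1-(4b), with rung (4a) as the displayed hypothesis `h4a`): in a relatively
closed invariant subspace `V` with a non-zero member there are a test function `f`, a non-zero `μ` and a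
non-zero `ψ ∈ V` with `R(f*)(R(f)ψ) = μ ψ` — the compact self-adjoint `T_{f*} ∘ T_f` is non-zero on the
`L²`-closure of the classes of `V` (`(4a)` + `‖T_f ψ₀‖² = ⟪T ψ₀, ψ₀⟫`), the spectral theorem gives an eigenvector
there, and `μ⁻¹ · K_{f*}(T_f u)` is its continuous invariant representative, in `V` by relative closedness. -/
theorem exists_eigen_mem [SecondCountableTopology G] (V : Set (G → ℂ)) (hV : S.IsInvariantSubspace V)
    (hclosed : ∀ ψ : G → ℂ, Continuous ψ → S.Invariant ψ →
      (∀ ε : ℝ, 0 < ε → ∃ ψ' ∈ V,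
        eLpNorm (fun x => ψ x - ψ' x) 2 (S.μ.restrict S.DG) < ENNReal.ofReal ε) → ψ ∈ V)
    (hne : ∃ ψ ∈ V, ∃ x, ψ x ≠ 0)
    (h4a : ∀ ψ : Lp ℂ 2 (S.μ.restrict S.DG), ψ ≠ 0 →
      ∃ f : G → ℂ, IsTest f ∧ ¬ (S.kernelOp f ψ =ᵐ[S.μ.restrict S.DG] 0)) :
    ∃ f : G → ℂ, IsTest f ∧ ∃ μ : ℂ, μ ≠ 0 ∧ ∃ ψ ∈ V, (∃ x, ψ x ≠ 0) ∧
      ∀ x, S.R (cj (refl f)) (S.R f ψ) x = μ * ψ x := by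
  haveI := S.haar
  haveI : Countable S.Gk := S.countable_Gk
  haveI : IsFiniteMeasure (S.μ.restrict S.DG) := isFiniteMeasure_restrict.mpr S.measure_DG_ne_top
  obtain ⟨ψ₀, hψ₀V, x₀, hx₀⟩ := hne
  have hVne : V.Nonempty := ⟨ψ₀, hψ₀V⟩
  -- the class of `ψ₀` is non-zero
  set u₀ : Lp ℂ 2 (S.μ.restrict S.DG) := (S.memLp_two_DG (hV.cont ψ₀ hψ₀V)).toLp ψ₀ with hu₀
  have hu₀ae : ⇑u₀ =ᵐ[S.μ.restrict S.DG] ψ₀ := MemLp.coeFn_toLp _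
  have hu₀ne : u₀ ≠ 0 := by
    intro h0
    have h1 : ψ₀ =ᵐ[S.μ.restrict S.DG] (0 : G → ℂ) := by
      have := Lp.eq_zero_iff_ae_eq_zero.mp h0
      exact hu₀ae.symm.trans this
    have := S.eq_of_ae_eq_DG (hV.inv ψ₀ hψ₀V) (hV.cont ψ₀ hψ₀V) (fun _ _ => rfl) continuous_const h1
    exact hx₀ (by rw [this]; rfl)
  -- (4a): a test function `f` with `T_f u₀ ≠ 0`
  obtain ⟨f, hf, hfu₀⟩ := h4a u₀ hu₀ne
  obtain ⟨T₂, hT₂⟩ := S.exists_kernelCLM hf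
  obtain ⟨T₁, hT₁⟩ := S.exists_kernelCLM hf.refl.cj
  have hT₂u₀ : T₂ u₀ ≠ 0 := by
    intro h0
    apply hfu₀
    have := Lp.eq_zero_iff_ae_eq_zero.mp h0
    exact (hT₂ u₀).symm.trans this
  -- the closed invariant subspace `W` and the compact symmetric `T = T₁ ∘ T₂` on it
  set W := (S.classes V hV hVne).topologicalClosure with hW
  have hWc : IsClosed (W : Set (Lp ℂ 2 (S.μ.restrict S.DG))) := Submodule.isClosed_topologicalClosure _
  set T := T₁.comp T₂ with hTdef
  have hTinv : ∀ w ∈ W, T w ∈ W := fun w hw =>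
    S.kernelCLM_mapsTo_closure hV hVne hf.refl.cj T₁ hT₁ _ (S.kernelCLM_mapsTo_closure hV hVne hf T₂ hT₂ w hw)
  have hu₀W : u₀ ∈ W := Submodule.le_topologicalClosure _ ⟨ψ₀, hψ₀V, hu₀ae⟩
  have hTu₀ : T u₀ ≠ 0 := by
    intro h0
    have := S.inner_kernelCLM_comp_self hf T₁ T₂ hT₁ hT₂ u₀
    rw [← hTdef, h0, inner_zero_left] at this
    have h2 : (‖T₂ u₀‖ : ℂ) = 0 := pow_eq_zero_iff (n := 2) (by norm_num) |>.mp this.symm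
    exact hT₂u₀ (norm_eq_zero.mp (by exact_mod_cast h2))
  obtain ⟨μ, hμ, u, huW, hu0, hu⟩ := exists_eigenvector_mem_of_ne_zero
    (S.kernelCLM_comp_isCompactOperator hf T₁ T₂ hT₂) (S.kernelCLM_comp_isSymmetric hf T₁ T₂ hT₁ hT₂)
    hWc hTinv ⟨u₀, hu₀W, hTu₀⟩
  -- the continuous invariant representative `ψ := μ⁻¹ • K_{f*}(T₂ u)`
  have hT₂u_int : Integrable (⇑(T₂ u)) (S.μ.restrict S.DG) := (Lp.memLp (T₂ u)).integrable (by norm_num)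
  set ψ : G → ℂ := fun x => μ⁻¹ * S.kernelOp (cj (refl f)) (⇑(T₂ u)) x with hψdef
  have hψc : Continuous ψ := continuous_const.mul (S.continuous_kernelOp hf.refl.cj hT₂u_int)
  have hψinv : S.Invariant ψ := fun γ x => by
    simp only [hψdef]
    rw [S.kernelOp_invariant (cj (refl f)) (⇑(T₂ u)) γ x]
  have huψ : ⇑u =ᵐ[S.μ.restrict S.DG] ψ := by
    have e : u = μ⁻¹ • T u := by rw [hu, smul_smul, inv_mul_cancel₀ hμ, one_smul]
    have h1 : ⇑(T u) =ᵐ[S.μ.restrict S.DG] S.kernelOp (cj (refl f)) (⇑(T₂ u)) := hT₁ (T₂ u)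
    rw [e]
    filter_upwards [Lp.coeFn_smul μ⁻¹ (T u), h1] with x h2 h3
    rw [h2, Pi.smul_apply, smul_eq_mul, h3]
  -- `ψ ∈ V` by relative closedness (`u ∈ W`)
  have hψV : ψ ∈ V := by
    refine hclosed ψ hψc hψinv fun ε hε => ?_
    have huW' : u ∈ closure (S.classes V hV hVne : Set (Lp ℂ 2 (S.μ.restrict S.DG))) := by
      rw [← Submodule.topologicalClosure_coe]; exact huW
    obtain ⟨u', hu'W, hdist⟩ := Metric.mem_closure_iff.mp huW' ε hε
    obtain ⟨ψ', hψ'V, hu'⟩ := hu'W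
    refine ⟨ψ', hψ'V, ?_⟩
    have e : eLpNorm (fun x => ψ x - ψ' x) 2 (S.μ.restrict S.DG) = eLpNorm (⇑(u - u')) 2 (S.μ.restrict S.DG) := by
      apply eLpNorm_congr_ae
      filter_upwards [Lp.coeFn_sub u u', huψ, hu'] with x h1 h2 h3
      rw [h1, Pi.sub_apply, h2, h3]
    rw [e, ← ENNReal.ofReal_toReal (Lp.eLpNorm_lt_top (u - u')).ne, ← Lp.norm_def]
    rw [ENNReal.ofReal_lt_ofReal_iff hε]
    rwa [dist_eq_norm] at hdist
  -- `ψ` is not identically zero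
  have hψne : ∃ x, ψ x ≠ 0 := by
    by_contra hall
    have h0 : ψ = 0 := funext fun x => by by_contra hx; exact hall ⟨x, hx⟩
    apply hu0
    rw [Lp.eq_zero_iff_ae_eq_zero]
    filter_upwards [huψ] with x hx
    rw [hx, h0]
  -- the eigen-equation as functions
  refine ⟨f, hf, μ, hμ, ψ, hψV, hψne, fun x => ?_⟩
  have hRψ : S.R f ψ = S.kernelOp f (⇑u) := by
    rw [S.kernelOp_congr_ae f huψ]
    exact funext fun y => (S.kernelOp_eq_R hf hψinv hψc y).symm
  have hRψV : S.R f ψ ∈ V := hV.conv ψ hψV f hf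
  rw [← S.kernelOp_eq_R hf.refl.cj (hV.inv _ hRψV) (hV.cont _ hRψV) x, hRψ,
    S.kernelOp_congr_ae (cj (refl f)) (hT₂ u).symm]
  simp only [hψdef]
  rw [← mul_assoc, mul_inv_cancel₀ hμ, one_mul]

end Setting

end RTF

end Summit.Ventures.HodgeRepro.Tier4.Line1
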